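import Mathlib
import Summits.Ventures.HodgeRepro2.T5DixmierSchur
import Summits.Ventures.HodgeRepro2.T5SchurRepresentation

/-!
# Schur's lemma for Mathlib-irreducible representations, and the «onto maps» kernel identity

Blind cell `pub-hodge-repro2`, seat p8 (gen 5), Tier-5 kernel support.  Two bridges:

1. **Δ-N3.12-b in kernel form** (route/T5-CHECK-N3-p8.md v5 §9, adopted as a reading note in
   route/T5-N3-route-2.md §N3.13.2): Howe's `𝒩_ρ` is the intersection of the kernels of the maps
   ONTO `ρ` (the `𝒩` with `𝒫/𝒩 ≅ ρ`), while `T5TensorSeparation` (p391188) intersects over ALL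
   maps `𝒫 → ρ`; for a simple `ρ` the two intersections coincide, because a non-surjective map
   to a simple module is zero and contributes the trivial kernel (`iInf_ker_eq_iInf_surjective`,
   `iInf_ker_surjective_eq_iInf_quot`).
2. **Schur for `Representation.IsIrreducible`**: Mathlib's irreducibility
   (`IsSimpleOrder (Subrepresentation ρ)`) gives `IsSimpleModule k[G] ρ.asModule`
   (`Representation.irreducible_iff_isSimpleModule_asModule`), so the Dixmier-form results of
   `T5SchurRepresentation` (p392116) apply verbatim: equivariant endomorphisms and intertwining
   maps `ρ → ρ` are scalars for an irreducible representation of countable dimension over an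
   uncountable algebraically closed field, in particular for a smooth admissible irreducible
   representation along a countable basis of open subgroups; the central character exists.

README §8(d): uses an L-value-free non-vanishing device: NO.
-/

namespace Summit.Ventures.HodgeRepro2.T5SchurIrreducible

open Cardinal

section Kernels

variable {R P N : Type*} [Ring R] [AddCommGroup P] [Module R P] [AddCommGroup N] [Module R N]
  [IsSimpleModule R N]

/-- **Δ-N3.12-b.** For a simple target `N`, the intersection of the kernels of ALL maps `P → N`
equals the intersection over the SURJECTIVE ones. -/
theorem iInf_ker_eq_iInf_surjective :
    (⨅ f : P →ₗ[R] N, LinearMap.ker f) =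
      ⨅ f : {f : P →ₗ[R] N // Function.Surjective f}, LinearMap.ker f.1 := by
  apply le_antisymm
  · exact le_iInf fun f => iInf_le (fun f : P →ₗ[R] N => LinearMap.ker f) f.1
  · refine le_iInf fun f => ?_
    rcases LinearMap.surjective_or_eq_zero f with hs | hz
    · exact iInf_le (fun f : {f : P →ₗ[R] N // Function.Surjective f} => LinearMap.ker f.1) ⟨f, hs⟩
    · rw [hz, LinearMap.ker_zero]
      exact le_top

omit [IsSimpleModule R N] in
/-- The kernels of the surjections `P → N` are exactly the submodules `M` with `P ⧸ M ≅ N`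
(Howe's «`𝒩` with `𝒫/𝒩 ≅ ρ`»): the two intersections agree. -/
theorem iInf_ker_surjective_eq_iInf_quot :
    (⨅ f : {f : P →ₗ[R] N // Function.Surjective f}, LinearMap.ker f.1) =
      ⨅ M : {M : Submodule R P // Nonempty ((P ⧸ M) ≃ₗ[R] N)}, M.1 := by
  apply le_antisymm
  · refine le_iInf fun M => ?_
    obtain ⟨e⟩ := M.2
    have hs : Function.Surjective (e.toLinearMap ∘ₗ M.1.mkQ) :=
      e.surjective.comp (Submodule.mkQ_surjective M.1)
    refine (iInf_le (fun f : {f : P →ₗ[R] N // Function.Surjective f} => LinearMap.ker f.1)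
      ⟨e.toLinearMap ∘ₗ M.1.mkQ, hs⟩).trans ?_
    rw [LinearEquiv.ker_comp, Submodule.ker_mkQ]
  · refine le_iInf fun f => ?_
    exact iInf_le (fun M : {M : Submodule R P // Nonempty ((P ⧸ M) ≃ₗ[R] N)} => M.1)
      ⟨LinearMap.ker f.1, ⟨f.1.quotKerEquivOfSurjective f.2⟩⟩

/-- Combined: `⋂_{all f} Ker f = ⋂_{𝒩 : P/𝒩 ≅ N} 𝒩` — the intersection of `T5TensorSeparation`
is Howe's `𝒩_ρ`. -/
theorem iInf_ker_eq_iInf_quot :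
    (⨅ f : P →ₗ[R] N, LinearMap.ker f) =
      ⨅ M : {M : Submodule R P // Nonempty ((P ⧸ M) ≃ₗ[R] N)}, M.1 :=
  iInf_ker_eq_iInf_surjective.trans iInf_ker_surjective_eq_iInf_quot

end Kernels

section Representations

open Summit.Ventures.HodgeRepro2.LevelPositivity
open Summit.Ventures.HodgeRepro2.T5SchurRepresentation

variable {G : Type*} [Group G] {k V : Type*} [Field k] [AddCommGroup V] [Module k V]
  (ρ : Representation k G V)

/-- **Schur (Dixmier form) for an irreducible representation** in Mathlib's sense: over an
uncountable algebraically closed field, an equivariant endomorphism of an irreducible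
representation of countable dimension is a scalar. -/
theorem exists_smul_eq_of_isIrreducible [IsAlgClosed k] (hk : ℵ₀ < #k) [ρ.IsIrreducible]
    (hV : Module.rank k V ≤ ℵ₀) (f : V →ₗ[k] V) (hf : ∀ g v, f (ρ g v) = ρ g (f v)) :
    ∃ c : k, ∀ v, f v = c • v :=
  exists_smul_eq_of_equivariant ρ hk hV f hf

/-- The same for a bundled intertwining map `ρ → ρ`. -/
theorem exists_smul_eq_intertwiningMap [IsAlgClosed k] (hk : ℵ₀ < #k) [ρ.IsIrreducible]
    (hV : Module.rank k V ≤ ℵ₀) (f : Representation.IntertwiningMap ρ ρ) :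
    ∃ c : k, ∀ v, f v = c • v :=
  exists_smul_eq_of_isIrreducible ρ hk hV f.toLinearMap f.isIntertwining

/-- **Schur for smooth admissible irreducible representations** (Mathlib irreducibility). -/
theorem exists_smul_eq_of_smooth_admissible_isIrreducible [TopologicalSpace G] [IsAlgClosed k]
    (hk : ℵ₀ < #k) [ρ.IsIrreducible] (hρ : IsSmooth ρ) {ι : Type*} [Countable ι]
    (K : ι → Subgroup G) (hbasis : ∀ U : Subgroup G, IsOpen (U : Set G) → ∃ i, K i ≤ U)
    [∀ i, FiniteDimensional k (invariants ρ (K i))] (f : V →ₗ[k] V)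
    (hf : ∀ g v, f (ρ g v) = ρ g (f v)) : ∃ c : k, ∀ v, f v = c • v :=
  exists_smul_eq_of_smooth_admissible ρ hk hρ K hbasis f hf

/-- Central elements of `G` act by scalars on an irreducible representation of countable
dimension. -/
theorem exists_smul_eq_of_mem_center_of_isIrreducible [IsAlgClosed k] (hk : ℵ₀ < #k)
    [ρ.IsIrreducible] (hV : Module.rank k V ≤ ℵ₀) {z : G} (hz : z ∈ Subgroup.center G) :
    ∃ c : k, ∀ v, ρ z v = c • v :=
  exists_smul_eq_of_mem_center ρ hk hV hz

/-- The central character `Z(G) →* k` of an irreducible representation of countable dimension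
(Mathlib irreducibility). -/
noncomputable def centralCharacterOfIsIrreducible [IsAlgClosed k] (hk : ℵ₀ < #k)
    [ρ.IsIrreducible] (hV : Module.rank k V ≤ ℵ₀) : Subgroup.center G →* k :=
  centralCharacter ρ hk hV

/-- `ρ z v = centralCharacterOfIsIrreducible z • v`. -/
theorem centralCharacterOfIsIrreducible_spec [IsAlgClosed k] (hk : ℵ₀ < #k) [ρ.IsIrreducible]
    (hV : Module.rank k V ≤ ℵ₀) (z : Subgroup.center G) (v : V) :
    ρ z v = centralCharacterOfIsIrreducible ρ hk hV z • v :=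
  centralCharacter_spec ρ hk hV z v

end Representations

section Complex

open Summit.Ventures.HodgeRepro2.LevelPositivity
open Summit.Ventures.HodgeRepro2.T5DixmierSchur

variable {G : Type*} [Group G] {V : Type*} [AddCommGroup V] [Module ℂ V]
  (ρ : Representation ℂ G V)

/-- Schur over `ℂ` for an irreducible representation of countable dimension. -/
theorem exists_smul_eq_of_isIrreducible_complex [ρ.IsIrreducible] (hV : Module.rank ℂ V ≤ ℵ₀)
    (f : V →ₗ[ℂ] V) (hf : ∀ g v, f (ρ g v) = ρ g (f v)) : ∃ c : ℂ, ∀ v, f v = c • v :=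
  exists_smul_eq_of_isIrreducible ρ aleph0_lt_mk_complex hV f hf

/-- Schur over `ℂ` for a smooth admissible irreducible representation. -/
theorem exists_smul_eq_of_smooth_admissible_isIrreducible_complex [TopologicalSpace G]
    [ρ.IsIrreducible] (hρ : IsSmooth ρ) {ι : Type*} [Countable ι] (K : ι → Subgroup G)
    (hbasis : ∀ U : Subgroup G, IsOpen (U : Set G) → ∃ i, K i ≤ U)
    [∀ i, FiniteDimensional ℂ (invariants ρ (K i))] (f : V →ₗ[ℂ] V)
    (hf : ∀ g v, f (ρ g v) = ρ g (f v)) : ∃ c : ℂ, ∀ v, f v = c • v :=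
  exists_smul_eq_of_smooth_admissible_isIrreducible ρ aleph0_lt_mk_complex hρ K hbasis f hf

end Complex

end Summit.Ventures.HodgeRepro2.T5SchurIrreducible
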